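import Summits.ValiantsHypothesis.ValiantsHypothesis.Theorems.SymPencilPerFourInnerRankNine
import Summits.ValiantsHypothesis.ValiantsHypothesis.Theorems.SymPencilBoxFourEquality
import Summits.ValiantsHypothesis.ValiantsHypothesis.Theorems.SymPencilSdcPerFourTwentySixReduction

/-!
# Route `SymPencil` — the cell hypothesis `H88` PROVED: no `8`-dimensional singular subspace of
# `per_4` carries a joint `8`-square family; the rung `26` reduction needs only `H106` now
# (`--supports` stmt-ValiantsHypothesis-5674 `SdcSuperquadratic`; Task T2 of
# `Cruxes/SdcSuperquadratic/NEXT-RUNG-25.md` discharged; rung currency only)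

**Theorem** (`not_joint_eight_squares`, the hypothesis `H88` of
`SymPencilSdcPerFourTwentySixReduction.eq_twentyFive_and_oneRowKernel_of_le_twentyFive`,
verbatim).  Let `K` have characteristic `0`, `V ≤ K^{4×4}` an `8`-dimensional subspace on which
all `3 × 3` subpermanents vanish (i.e. `V ⊆ Sing Z(per_4)`), `c : Fin 8 → K` and `β_k` bilinear
forms on `K^{4×4}`.  Then it is NOT the case that for every base point `u` and every `y ∈ V`,
`per_4 (u + s y) = e₀ + e₁ s + s² Σ_k c_k β_k(u, y)²`.

Proof.  By the BoxFour equality case (`SymPencilBoxFourEquality.two_rows_or_two_cols`) `V` is the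
block of matrices with two prescribed zero rows or columns; transporting the family along row
permutations and transposition (`joint_family_map`) we may take the rows `0, 1` zero, so `V`
contains every matrix supported on the rows `2, 3` (`SymPencilPerFourTwoRowsRadical.mem_of_rows01`).
For `u = (a; b; 0; 0)` and `y = (0; 0; y₂; y₃)`, `per_4 (u + s y) = s² per (a; b; y₂; y₃)`, so the
`s²`-coefficient identity reads `Σ_k c_k t_k((a,b),(y₂,y₃))² = per (a; b; y₂; y₃)` with the
bilinear forms `t_k((a,b),(y₂,y₃)) = β_k((a;b;0;0), (0;0;y₂;y₃))` — a joint `8`-square family in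
the sense of `SymPencilPerFourInnerRankNine`, which does not exist
(`false_of_joint_eight_squares`: the inner rank of the `2 | 2` row split of `per_4` is `≥ 9`).

**Corollary** (`eq_twentyFive_and_oneRowKernel_of_H106`).  The rung-`26` reduction of
val-width-5674-p3 with `H88` discharged: assuming only `H106` (no `6`-dimensional singular
subspace with a joint `4`-square family), a symmetric affine determinantal representation of
`per_4` of size `≤ 25` has size exactly `25`, Lagrangian kernel rows and a one-row (one-column)
kernel — the cell `(12, 4, 0)`.

Honest framing: `H88` was one of three open cells at `m = 25`; this file closes it.  The tree's
value `sdc(per_4) ≥ 25` (window `25 ≤ sdc(per₄) ≤ 29`) is unchanged; the rung `26` still needs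
`H106` AND the exclusion of the Lagrangian one-row pencil of size `25`; the crux
`SdcSuperquadratic` (a bound past the number-of-variables wall) and `VP ≠ VNP` are untouched.
No definitions, no named facts. [folklore]
-/

noncomputable section

-- single-conjunct layout: Sub = Summit, duplicated namespace component intended
set_option linter.dupNamespace false

namespace Summit.ValiantsHypothesis.ValiantsHypothesis.Theorems.SymPencilSdcPerFourInnerRankH88

open Matrix MvPolynomial Finset Module
open Literature.Computability.AlgebraicComplexity
open Summit.ValiantsHypothesis.ValiantsHypothesis.Theorems.SymPencilPerFourBlocks
open Summit.ValiantsHypothesis.ValiantsHypothesis.Theorems.SymPencilPerFourTwoRowsRadical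
open Summit.ValiantsHypothesis.ValiantsHypothesis.Theorems.SymPencilBoxFourEquality
open Summit.ValiantsHypothesis.ValiantsHypothesis.Theorems.SymPencilPerFourInnerRankRows
open Summit.ValiantsHypothesis.ValiantsHypothesis.Theorems.SymPencilPerFourInnerRankNine
open Summit.ValiantsHypothesis.ValiantsHypothesis.Theorems.SymPencilSdcPerFourTwentySixReduction

variable {K : Type*} [Field K]

/-! ### Transport of a joint family along a `per_4`-preserving linear automorphism -/

/-- **Transport.**  If `V` carries a joint family `per_4 (u + s y) = e₀ + e₁ s + s² Σ c_k β_k(u,y)²`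
(`y ∈ V`, all `u`) and `per_4 ∘ Φ = per_4`, then `Φ(V)` carries one with
`β'_k(u, y) = β_k(Φ⁻¹ u, Φ⁻¹ y)`. [folklore] -/
theorem joint_family_map (V : Submodule K (Fin 4 × Fin 4 → K))
    (Φ : (Fin 4 × Fin 4 → K) ≃ₗ[K] (Fin 4 × Fin 4 → K))
    (hΦ : ∀ z, eval (Φ z) (perPoly (Fin 4) K) = eval z (perPoly (Fin 4) K)) (c : Fin 8 → K)
    (β : Fin 8 → ((Fin 4 × Fin 4 → K) →ₗ[K] (Fin 4 × Fin 4 → K) →ₗ[K] K))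
    (h : ∀ u : Fin 4 × Fin 4 → K, ∀ y ∈ V, ∃ e₀ e₁ : K, ∀ s : K,
      eval (u + s • y) (perPoly (Fin 4) K) = e₀ + s * e₁ + s ^ 2 * ∑ k, c k * (β k u y) ^ 2) :
    ∀ u : Fin 4 × Fin 4 → K, ∀ y ∈ V.map Φ.toLinearMap, ∃ e₀ e₁ : K, ∀ s : K,
      eval (u + s • y) (perPoly (Fin 4) K) = e₀ + s * e₁ + s ^ 2 *
        ∑ k, c k * ((β k).compl₁₂ Φ.symm.toLinearMap Φ.symm.toLinearMap u y) ^ 2 := by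
  rintro u _ ⟨y, hy, rfl⟩
  obtain ⟨e₀, e₁, he⟩ := h (Φ.symm u) y hy
  refine ⟨e₀, e₁, fun s => ?_⟩
  have hu : u + s • Φ.toLinearMap y = Φ (Φ.symm u + s • y) := by
    rw [map_add, map_smul, LinearEquiv.apply_symm_apply]; rfl
  rw [hu, hΦ, he s]
  simp only [LinearMap.compl₁₂_apply, LinearEquiv.coe_toLinearMap, LinearEquiv.symm_apply_apply]

/-! ### Canonical position: rows `0, 1` zero -/

/-- `per_4` at `(a; b; 0; 0) + s (0; 0; y₂; y₃)` is the permanent of the matrix with rows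
`a, b, s y₂, s y₃`. [folklore] -/
theorem eval_rows01_add_smul_rows23 (a b y₂ y₃ : Fin 4 → K) (s : K) :
    eval ((fun p : Fin 4 × Fin 4 => if p.1 = 0 then a p.2 else if p.1 = 1 then b p.2 else 0) +
        s • (fun p : Fin 4 × Fin 4 => if p.1 = 2 then y₂ p.2 else if p.1 = 3 then y₃ p.2 else 0))
      (perPoly (Fin 4) K) = (Matrix.of ![a, b, s • y₂, s • y₃]).permanent := by
  rw [eval_perPoly]
  congr 1
  ext i j
  fin_cases i <;> simp

/-- **Canonical position.**  If `V` (`dim 8`, rows `0, 1` zero) carries a joint `8`-square family,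
contradiction: its `s²`-coefficients form a joint `8`-square family for the `2 | 2` row split of
`per_4`, excluded by `SymPencilPerFourInnerRankNine.false_of_joint_eight_squares`. [folklore] -/
theorem false_of_joint_rows01 [CharZero K] (V : Submodule K (Fin 4 × Fin 4 → K))
    (h8 : finrank K V = 8) (hV : ∀ x ∈ V, ∀ j, x (0, j) = 0 ∧ x (1, j) = 0) (c : Fin 8 → K)
    (β : Fin 8 → ((Fin 4 × Fin 4 → K) →ₗ[K] (Fin 4 × Fin 4 → K) →ₗ[K] K))
    (h : ∀ u : Fin 4 × Fin 4 → K, ∀ y ∈ V, ∃ e₀ e₁ : K, ∀ s : K,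
      eval (u + s • y) (perPoly (Fin 4) K) = e₀ + s * e₁ + s ^ 2 * ∑ k, c k * (β k u y) ^ 2) :
    False := by
  -- the two linear embeddings `(a, b) ↦ (a; b; 0; 0)` and `(y₂, y₃) ↦ (0; 0; y₂; y₃)`
  let EU : ((Fin 4 → K) × (Fin 4 → K)) →ₗ[K] (Fin 4 × Fin 4 → K) :=
    { toFun := fun ab p => if p.1 = 0 then ab.1 p.2 else if p.1 = 1 then ab.2 p.2 else 0
      map_add' := fun x y => by
        funext p
        simp only [Prod.fst_add, Prod.snd_add, Pi.add_apply]
        split_ifs <;> simp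
      map_smul' := fun s x => by
        funext p
        simp only [Prod.smul_fst, Prod.smul_snd, Pi.smul_apply, smul_eq_mul, RingHom.id_apply]
        split_ifs <;> simp }
  let EY : ((Fin 4 → K) × (Fin 4 → K)) →ₗ[K] (Fin 4 × Fin 4 → K) :=
    { toFun := fun y p => if p.1 = 2 then y.1 p.2 else if p.1 = 3 then y.2 p.2 else 0
      map_add' := fun x y => by
        funext p
        simp only [Prod.fst_add, Prod.snd_add, Pi.add_apply]
        split_ifs <;> simp
      map_smul' := fun s x => by
        funext p
        simp only [Prod.smul_fst, Prod.smul_snd, Pi.smul_apply, smul_eq_mul, RingHom.id_apply]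
        split_ifs <;> simp }
  have hEU : ∀ a b : Fin 4 → K, EU (a, b) =
      fun p : Fin 4 × Fin 4 => if p.1 = 0 then a p.2 else if p.1 = 1 then b p.2 else 0 :=
    fun a b => rfl
  have hEY : ∀ y₂ y₃ : Fin 4 → K, EY (y₂, y₃) =
      fun p : Fin 4 × Fin 4 => if p.1 = 2 then y₂ p.2 else if p.1 = 3 then y₃ p.2 else 0 :=
    fun y₂ y₃ => rfl
  have hmem : ∀ y₂ y₃ : Fin 4 → K, EY (y₂, y₃) ∈ V := fun y₂ y₃ =>
    mem_of_rows01 V h8 hV _ (fun j => by simp [hEY]) (fun j => by simp [hEY])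
  let t : Fin 8 → (((Fin 4 → K) × (Fin 4 → K)) →ₗ[K] ((Fin 4 → K) × (Fin 4 → K)) →ₗ[K] K) :=
    fun r => (β r).compl₁₂ EU EY
  refine false_of_joint_eight_squares c t fun a b y₂ y₃ => ?_
  obtain ⟨e₀, e₁, he⟩ := h (EU (a, b)) (EY (y₂, y₃)) (hmem y₂ y₃)
  have P : ∀ s : K, e₀ + s * e₁ + s ^ 2 * ∑ k, c k * (t k (a, b) (y₂, y₃)) ^ 2 =
      s ^ 2 * (Matrix.of ![a, b, y₂, y₃]).permanent := fun s => by
    have hs := he s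
    have hev : eval (EU (a, b) + s • EY (y₂, y₃)) (perPoly (Fin 4) K) =
        (Matrix.of ![a, b, s • y₂, s • y₃]).permanent := by
      rw [hEU, hEY]; exact eval_rows01_add_smul_rows23 a b y₂ y₃ s
    rw [hev, per_smul_row₂, per_smul_row₃] at hs
    rw [show ∑ k, c k * (t k (a, b) (y₂, y₃)) ^ 2 = ∑ k, c k * (β k (EU (a, b)) (EY (y₂, y₃))) ^ 2
      from rfl, ← hs]
    ring
  have h0 := P 0
  have h1 := P 1
  have h1' := P (-1)
  have h2 : (2 : K) * ∑ k, c k * (t k (a, b) (y₂, y₃)) ^ 2 =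
      2 * (Matrix.of ![a, b, y₂, y₃]).permanent := by
    linear_combination h1 + h1' - 2 * h0
  exact (mul_right_inj' two_ne_zero).1 h2

/-- **Two prescribed zero rows.** [folklore] -/
theorem false_of_joint_rows [CharZero K] (V : Submodule K (Fin 4 × Fin 4 → K))
    (h8 : finrank K V = 8) {p q : Fin 4} (hpq : p ≠ q)
    (hV : ∀ x ∈ V, ∀ j, x (p, j) = 0 ∧ x (q, j) = 0) (c : Fin 8 → K)
    (β : Fin 8 → ((Fin 4 × Fin 4 → K) →ₗ[K] (Fin 4 × Fin 4 → K) →ₗ[K] K))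
    (h : ∀ u : Fin 4 × Fin 4 → K, ∀ y ∈ V, ∃ e₀ e₁ : K, ∀ s : K,
      eval (u + s • y) (perPoly (Fin 4) K) = e₀ + s * e₁ + s ^ 2 * ∑ k, c k * (β k u y) ^ 2) :
    False := by
  obtain ⟨σ, hσ0, hσ1⟩ := exists_perm_zero_one p q hpq
  set e := Equiv.prodCongr σ (1 : Equiv.Perm (Fin 4)) with he
  set Φ : (Fin 4 × Fin 4 → K) ≃ₗ[K] (Fin 4 × Fin 4 → K) := LinearEquiv.funCongrLeft K K e with hΦ
  have hΦa : ∀ (x : Fin 4 × Fin 4 → K) (i j : Fin 4), Φ x (i, j) = x (σ i, j) := fun x i j => by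
    simp [hΦ, he]
  have hΦper : ∀ z, eval (Φ z) (perPoly (Fin 4) K) = eval z (perPoly (Fin 4) K) := fun z => by
    have : (Φ z : Fin 4 × Fin 4 → K) = z ∘ e := rfl
    rw [this, he, eval_perPoly_comp_prodCongr]
  have h' := joint_family_map V Φ hΦper c β h
  set V' := V.map Φ.toLinearMap with hV'def
  have h8' : finrank K V' = 8 := by rw [hV'def, LinearEquiv.finrank_map_eq, h8]
  have hV' : ∀ y ∈ V', ∀ j, y (0, j) = 0 ∧ y (1, j) = 0 := by
    rintro _ ⟨x, hx, rfl⟩ j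
    rw [LinearEquiv.coe_toLinearMap, hΦa, hΦa, hσ0, hσ1]
    exact hV x hx j
  exact false_of_joint_rows01 V' h8' hV' c _ h'

/-- **Two prescribed zero rows or columns.** [folklore] -/
theorem false_of_joint_rows_or_cols [CharZero K] (V : Submodule K (Fin 4 × Fin 4 → K))
    (h8 : finrank K V = 8)
    (hV : (∃ p q : Fin 4, p ≠ q ∧ ∀ x ∈ V, ∀ j, x (p, j) = 0 ∧ x (q, j) = 0) ∨
      (∃ p q : Fin 4, p ≠ q ∧ ∀ x ∈ V, ∀ i, x (i, p) = 0 ∧ x (i, q) = 0)) (c : Fin 8 → K)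
    (β : Fin 8 → ((Fin 4 × Fin 4 → K) →ₗ[K] (Fin 4 × Fin 4 → K) →ₗ[K] K))
    (h : ∀ u : Fin 4 × Fin 4 → K, ∀ y ∈ V, ∃ e₀ e₁ : K, ∀ s : K,
      eval (u + s • y) (perPoly (Fin 4) K) = e₀ + s * e₁ + s ^ 2 * ∑ k, c k * (β k u y) ^ 2) :
    False := by
  rcases hV with ⟨p, q, hpq, hV⟩ | ⟨p, q, hpq, hV⟩
  · exact false_of_joint_rows V h8 hpq hV c β h
  · -- transpose, then the row case
    set Φ : (Fin 4 × Fin 4 → K) ≃ₗ[K] (Fin 4 × Fin 4 → K) :=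
      LinearEquiv.funCongrLeft K K (Equiv.prodComm (Fin 4) (Fin 4)) with hΦ
    have hΦa : ∀ (x : Fin 4 × Fin 4 → K) (i j : Fin 4), Φ x (i, j) = x (j, i) := fun x i j => rfl
    have h' := joint_family_map V Φ eval_perPoly_transpose c β h
    set V' := V.map Φ.toLinearMap with hV'def
    have h8' : finrank K V' = 8 := by rw [hV'def, LinearEquiv.finrank_map_eq, h8]
    have hV' : ∀ y ∈ V', ∀ j, y (p, j) = 0 ∧ y (q, j) = 0 := by
      rintro _ ⟨x, hx, rfl⟩ j
      rw [LinearEquiv.coe_toLinearMap, hΦa, hΦa]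
      exact hV x hx j
    exact false_of_joint_rows V' h8' hpq hV' c _ h'

/-! ### `H88` -/

/-- **`H88` (cell hypothesis of `SymPencilSdcPerFourTwentySixReduction`, verbatim): no
`8`-dimensional subspace of `Sing Z(per_4)` carries a joint `8`-square family** — the inner rank
of `per_4` along an `8`-dimensional singular subspace is `≥ 9` (characteristic `0`).
[folklore] -/
theorem not_joint_eight_squares (K : Type*) [Field K] [CharZero K] :
    ∀ V : Submodule K (Fin 4 × Fin 4 → K),
      (∀ x ∈ V, ∀ (r c : Fin 3 → Fin 4), Function.Injective r → Function.Injective c →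
        ((Matrix.of fun i j => x (i, j)).submatrix r c).permanent = 0) →
      finrank K V = 8 → ∀ (c : Fin 8 → K)
        (β : Fin 8 → ((Fin 4 × Fin 4 → K) →ₗ[K] (Fin 4 × Fin 4 → K) →ₗ[K] K)),
      ¬ (∀ u : Fin 4 × Fin 4 → K, ∀ y ∈ V, ∃ e₀ e₁ : K, ∀ s : K,
          eval (u + s • y) (perPoly (Fin 4) K) = e₀ + s * e₁ + s ^ 2 * ∑ k, c k * (β k u y) ^ 2) :=
  fun V hV h8 c β h => false_of_joint_rows_or_cols V h8 (two_rows_or_two_cols V hV h8) c β h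

/-- **The rung-`26` reduction with `H88` discharged.**  Assuming only `H106` (no `6`-dimensional
singular subspace of `per_4` carries a joint `4`-square family), a symmetric affine determinantal
representation of `per_4` of size `m ≤ 25` over a field of characteristic `0` has `m = 25`,
Lagrangian kernel rows (`2 · dim im bL = 24`) and a `4`-dimensional kernel inside one row or one
column (`SymPencilSdcPerFourTwentySixReduction.eq_twentyFive_and_oneRowKernel_of_le_twentyFive`
∘ `not_joint_eight_squares`). [folklore] -/
theorem eq_twentyFive_and_oneRowKernel_of_H106 (K : Type*) [Field K] [CharZero K]
    (H106 : ∀ V : Submodule K (Fin 4 × Fin 4 → K),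
      (∀ x ∈ V, ∀ (r c : Fin 3 → Fin 4), Function.Injective r → Function.Injective c →
        ((Matrix.of fun i j => x (i, j)).submatrix r c).permanent = 0) →
      finrank K V = 6 → ∀ (c : Fin 4 → K)
        (β : Fin 4 → ((Fin 4 × Fin 4 → K) →ₗ[K] (Fin 4 × Fin 4 → K) →ₗ[K] K)),
      ¬ (∀ u : Fin 4 × Fin 4 → K, ∀ y ∈ V, ∃ e₀ e₁ : K, ∀ s : K,
          eval (u + s • y) (perPoly (Fin 4) K) = e₀ + s * e₁ + s ^ 2 * ∑ k, c k * (β k u y) ^ 2))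
    {m : ℕ} (hm : m ≤ 25) {A : Matrix (Fin m) (Fin m) (MvPolynomial (Fin 4 × Fin 4) K)}
    (hS : A.IsSymm) (hA : IsAffineDetRepr (perPoly (Fin 4) K) A) :
    m = 25 ∧
    ∃ (i₀ : Fin m) (D : Matrix {i // i ≠ i₀} {i // i ≠ i₀} K)
      (bL : (Fin 4 × Fin 4 → K) →ₗ[K] ({i // i ≠ i₀} → K))
      (CL : (Fin 4 × Fin 4 → K) →ₗ[K] Matrix {i // i ≠ i₀} {i // i ≠ i₀} K) (κ : K),
      IsUnit D.det ∧ Dᵀ = D ∧ (∀ z, (CL z)ᵀ = CL z) ∧ κ ≠ 0 ∧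
      (∀ z, bL z ⬝ᵥ D⁻¹ *ᵥ bL z = 0) ∧
      (∀ z, bL z ⬝ᵥ (D⁻¹ * CL z * D⁻¹) *ᵥ bL z = 0) ∧
      (∀ z, D.det * (bL z ⬝ᵥ (D⁻¹ * CL z * D⁻¹ * CL z * D⁻¹) *ᵥ bL z) =
        -(κ * eval z (perPoly (Fin 4) K))) ∧
      2 * finrank K (LinearMap.range bL) = 24 ∧ finrank K (LinearMap.ker bL) = 4 ∧
      ((∃ l : Fin 4, ∀ x ∈ LinearMap.ker bL, ∀ i j : Fin 4, i ≠ l → x (i, j) = 0) ∨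
       (∃ c : Fin 4, ∀ x ∈ LinearMap.ker bL, ∀ i j : Fin 4, j ≠ c → x (i, j) = 0)) :=
  eq_twentyFive_and_oneRowKernel_of_le_twentyFive K (not_joint_eight_squares K) H106 hm hS hA

end Summit.ValiantsHypothesis.ValiantsHypothesis.Theorems.SymPencilSdcPerFourInnerRankH88

end
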